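import Summits.BirchSwinnertonDyer.BirchSwinnertonDyer.Theorems.ByReductionTypeAtTwoMultUpperHalfTower
import HarnessLib

/-!
# Route `ByReductionTypeAtTwo`, crux `MultUpperHalfAtTwo` (item stmt-BirchSwinnertonDyer-19922): the TOWER road at a
# NON-SPLIT multiplicative `2` WITHOUT the Greenberg–Stevens binder — per member and for the class

HONEST FRAMING (cell `bsd-2adic`, run/shared/lean/pub/bsd-2adic/, seat `bsd-2adic-mult-2` GEN 6, HUMAN RULING D-0074 row (A)):
research route; THEOREMS ONLY (no definition, no new named fact); nothing is booked; BSD is not proved by any of this.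
PARTITION: X5@2 mult (K4ᵐ, RESIDUAL-MAP B1·O1; 1 976 book230 classes; the 1 273 NON-SPLIT ones) × p = 2 — types-the-object-of
(the per-class door of the TOWER road at a non-split `2` with ONE memo binder instead of two); closes none. bears_on: K4
(route-BirchSwinnertonDyer-ByReductionTypeAtTwo item 19922).

WHY THIS FILE. GEN 3's tower doors `missingUpperBoundAt_two_mult_of_towerGap_of_eulerChar` (per member) and
`missingUpperBoundAt_two_mult_of_towerGapMember'` (class; p436130) are stated for EITHER sign at `2` and therefore display
the Greenberg–Stevens binder `hGS` (MEMO, mult/PROOF-GS2.md RC-4; consumed only on the SPLIT branch of road (i), where the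
trivial zero of the Mazur–Tate–Teitelbaum `2`-adic `L`-function is charged to the `𝓛`-invariant). At a NON-SPLIT `2` the
binder is idle: the per-member door asks for `W.HasSplitMultiplicativeReductionAtPrime 2 → greenberg_stevens`, which
`¬ W.HasSplitMultiplicativeReductionAtPrime 2` discharges by `absurd`. This file records the two GS-FREE forms, so that a
per-class file of a NON-SPLIT class (GEN 4 tranche 3, GEN 5 «neither», GEN 6 tranche 4) displays exactly ONE memo binder —
Kato's divisibility `⊗ℚ` at a multiplicative `2` (`hKato`, K11a, mult/PROOF-MULT.md RC-2; the object of seat bsd-2adic-mult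
GEN 9's kernel road) — next to PRINT and certificates:

* §1 `missingUpperBoundAt_two_nonsplit_of_towerGap_of_eulerChar` — per member, control slot abstract (`hEC`), non-split.
* §2 `missingUpperBoundAt_two_nonsplit_of_towerGapMember'` — the CLASS theorem on the guarded print: a non-split member
  `W₁ ~_ℚ W` with a tower-gap certificate `O1.TowerGapAtTwo W₁` and a period datum (`Irr W₁ 2`, or a lattice-optimal
  parametrisation datum at level `N_{W₁}`, or `0 ≤ ord₂ ϖ` displayed) ⟹ `MissingUpperBoundAt W 2` at every member.
  (Being non-split at `2` is NOT isogeny-invariant in general only through the model; the hypothesis is placed on the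
  certified member `W₁`, where the per-class files decide it on Cremona's minimal model.)

WHAT IS DISPLAYED, NOT PROVED: PRINT {guarded Thm-4.1 analogue `h41ns'`, A236 `h41sp` (idle at non-split but part of the
either-sign road-(i) door), `hmod`, `hGZK`, `hCassels`, `hC`}; MEMO {`hKato` K11a}; the certificate `O1.TowerGapAtTwo W₁` and
the period datum. ∀-LEVEL CONTENT: none (a tower-certified curve is ON road (i): `mu_eq_zero_of_towerGapAtTwo`).

References: R. Greenberg, LNM 1716 (1999), §3 pp. 85–94, §4 pp. 112–113; K. Kato, Astérisque 295 (2004), Thm. 17.4, §17.13;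
L. Washington, Introduction to Cyclotomic Fields, §13.2; K. Česnavičius (2018) Thm. 1.2; J. W. S. Cassels, Arithmetic VIII
(1965); R. L. Miller, LMS J. Comput. Math. 14 (2011) Def. 1.1.
-/

set_option autoImplicit false
-- the Theorems namespace of this sub repeats the summit name by design (D-0017 nested layout: Summit.<S>.<Sub>)
set_option linter.dupNamespace false

noncomputable section

open scoped Classical MatrixGroups ModularForm

open NumberField IsDedekindDomain CongruenceSubgroup WeierstrassCurve Literature.NumberTheory.EllipticCurves
  Literature.NumberTheory.EllipticCurves.ModularForms
  Literature.NumberTheory.EllipticCurves.Greenberg1999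
  Literature.NumberTheory.EllipticCurves.Rank1Residual
  Literature.NumberTheory.EllipticCurves.Rank1Residual.Typed
  Summit.BirchSwinnertonDyer.Rank1Residual.X5

namespace Summit.BirchSwinnertonDyer.BirchSwinnertonDyer.Theorems

/-! ## §1 Per member, non-split: no Greenberg–Stevens binder -/

/-- **ROAD (tower) per member at a NON-SPLIT `2`, `hEC`-abstract, GS-FREE.** For a globally minimal elliptic `W/ℚ` of analytic
rank `0`, multiplicative and NON-SPLIT at `2`: Kato's divisibility `⊗ℚ` at `2` (`hKato`, MEMO K11a), the non-split control
display `hEC`, A236 `h41sp`, modularity, GZK, the period datum `0 ≤ ord₂ ϖ` and a tower-gap certificate `O1.TowerGapAtTwo W`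
⟹ `MissingUpperBoundAt W 2`. This is `missingUpperBoundAt_two_mult_of_towerGap_of_eulerChar` with its guarded Greenberg–Stevens
slot discharged by `hns`. [cite: Washington1997, §13.2] [cite: Kato2004Asterisque, Thm. 17.4 (p. 273) and 17.13]
[cite: GreenbergLNM1716, §4 pp. 112–113] [cite: Miller2011LMS, Def. 1.1] -/
theorem missingUpperBoundAt_two_nonsplit_of_towerGap_of_eulerChar (W : WeierstrassCurve ℚ) [W.IsElliptic]
    [W.IsGloballyMinimal] (hKato : O1.KatoMultiplicativeDivisibilityRat W 2)
    (hEC : O1.TwoAdicEulerCharRankZeroNonsplitMult W 0)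
    (h41sp : thm41Analogue_charValue_rankZero_split_baseChange_anyPrime)
    (hmod : nonempty_modularParametrizationData)
    (hGZK : rank_eq_analyticRank_of_analyticRank_le_one)
    (hper₀ : ∀ [NeZero (W.conductorNorm ℤ)] (f : CuspForm (Gamma0 (W.conductorNorm ℤ)) 2),
      IsNewformOf W f → ∀ ϖ : ℚ, (ϖ : ℝ) * W.realPeriodRat = plusPeriod f → 0 ≤ padicValRat 2 ϖ)
    (hgap : O1.TowerGapAtTwo W) (hr : W.analyticRank = 0) (hmult : Mult W 2)
    (hns : ¬ W.HasSplitMultiplicativeReductionAtPrime 2) :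
    MissingUpperBoundAt W 2 :=
  missingUpperBoundAt_two_mult_of_towerGap_of_eulerChar W hKato hEC h41sp hmod hGZK (fun h ↦ absurd h hns) hper₀
    hgap hr hmult

/-! ## §2 The class theorem on the guarded print, non-split member, GS-free -/

/-- **ROAD (tower) for the CLASS from a NON-SPLIT member, GS-FREE (GUARDED print).** For `W` of analytic rank `0`
multiplicative at `2` and an isogenous globally minimal member `W₁ ~_ℚ W`, NON-SPLIT multiplicative at `2`, carrying (a) a
tower-gap certificate `O1.TowerGapAtTwo W₁` and (b) a period datum — `Irr W₁ 2` (then `ord₂ ϖ = 0` is PRINT: Česnavičius +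
odd isogenies), or a lattice-optimal parametrisation datum at level `N_{W₁}`, or `0 ≤ ord₂ ϖ` displayed —, the upper half
`MissingUpperBoundAt W 2` holds at EVERY member, from PRINT {guarded Thm-4.1 analogue `h41ns'`, A236 `h41sp`, modularity,
GZK, Cassels, Česnavičius `hC`} + ONE MEMO {Kato `⊗ℚ` at a multiplicative `2` for every non-CM curve (`hKato`, K11a)}.
Same proof as `missingUpperBoundAt_two_mult_of_towerGapMember'` with §1 in place of the either-sign per-member door.
[cite: GreenbergLNM1716, §3 Note (p. 93) and §4 pp. 112–113] [cite: Cesnavicius2018, Thm. 1.2] [cite: Cassels1965ArithmeticVIII]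
[cite: Washington1997, §13.2] [cite: Miller2011LMS, Def. 1.1] -/
theorem missingUpperBoundAt_two_nonsplit_of_towerGapMember'
    (hKato : ∀ (W : WeierstrassCurve ℚ) [W.IsElliptic] [W.IsGloballyMinimal],
      ¬ W.HasCM → Mult W 2 → O1.KatoMultiplicativeDivisibilityRat W 2)
    (h41ns' : thm41Analogue_charValue_rankZero_numberField_anyPrime_oddLocalDegree)
    (h41sp : thm41Analogue_charValue_rankZero_split_baseChange_anyPrime)
    (hmod : nonempty_modularParametrizationData)
    (hGZK : rank_eq_analyticRank_of_analyticRank_le_one)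
    (hCassels : bsdRHS_eq_of_isIsogenous)
    (hC : cesnavicius_not_two_dvd_maninConstant_of_two_dvd_level)
    (W : WeierstrassCurve ℚ) [W.IsElliptic] [W.IsGloballyMinimal]
    (hr : W.analyticRank = 0) (hmult : Mult W 2)
    (W₁ : WeierstrassCurve ℚ) [W₁.IsElliptic] [W₁.IsGloballyMinimal] (hiso : IsIsogenous W W₁)
    (hns₁ : ¬ W₁.HasSplitMultiplicativeReductionAtPrime 2)
    (hgap : O1.TowerGapAtTwo W₁)
    (hB : Irr W₁ 2 ∨
      (∀ [NeZero (W₁.conductorNorm ℤ)],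
        ∃ D : ModularParametrizationData W₁ (W₁.conductorNorm ℤ), Zhai2021.IsOptimalDatum W₁ D) ∨
      (∀ [NeZero (W₁.conductorNorm ℤ)] (f : CuspForm (Gamma0 (W₁.conductorNorm ℤ)) 2),
        IsNewformOf W₁ f → ∀ ϖ : ℚ, (ϖ : ℝ) * W₁.realPeriodRat = plusPeriod f →
          0 ≤ padicValRat 2 ϖ)) :
    MissingUpperBoundAt W 2 := by
  -- the class data at `W₁`
  have hmult₁ : Mult W₁ 2 :=
    Summit.BirchSwinnertonDyer.Rank1Residual.X2.IsogenyQuotientLine.hasMultiplicativeReductionAtPrime_of_isIsogenous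
      hiso hmult
  have hr₁ : W₁.analyticRank = 0 := (analyticRank_eq_of_isIsogenous' hiso).symm.trans hr
  have hcm₁ : ¬ W₁.HasCM := fun h ↦ Rank1Residual.not_mult_of_hasCM W₁ h 2 hmult₁
  -- the period datum at `W₁`
  have hper₁ : ∀ [NeZero (W₁.conductorNorm ℤ)] (f : CuspForm (Gamma0 (W₁.conductorNorm ℤ)) 2),
      IsNewformOf W₁ f → ∀ ϖ : ℚ, (ϖ : ℝ) * W₁.realPeriodRat = plusPeriod f →
        0 ≤ padicValRat 2 ϖ := by
    rcases hB with hirr | hopt | hper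
    · intro _ f hf ϖ hϖ
      exact (padicValRat_periodRatio_eq_zero_of_irr_two hC W₁ hmult₁ hirr f hf ϖ hϖ).ge
    · intro _ f hf ϖ hϖ
      obtain ⟨D, hD⟩ := hopt
      exact (padicValRat_periodRatio_eq_zero_of_isOptimalDatum hC W₁ hmult₁ D hD f hf ϖ hϖ).ge
    · exact hper
  -- §1 at `W₁` on the guarded control display, then Cassels
  have hU₁ : MissingUpperBoundAt W₁ 2 :=
    missingUpperBoundAt_two_nonsplit_of_towerGap_of_eulerChar W₁ (hKato W₁ hcm₁ hmult₁)
      (O1.twoAdicEulerCharRankZeroNonsplitMult_zero_of_greenberg' W₁ h41ns') h41sp hmod hGZK hper₁ hgap hr₁ hmult₁ hns₁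
  exact missingUpperBoundAt_two_of_isogenous_member hmod hGZK hCassels W hr W₁ hiso hU₁

/-- **The same with Kato's divisibility displayed AT THE CERTIFIED MEMBER only** (`hKato₁ : O1.KatoMultiplicativeDivisibilityRat W₁ 2`
instead of the lane-wide binder): the form a per-class discharge of K11a at `W₁` would feed. [cite: Kato2004Asterisque, Thm. 17.4 and §17.13]
[cite: GreenbergLNM1716, §4 pp. 112–113] [cite: Cassels1965ArithmeticVIII] [cite: Miller2011LMS, Def. 1.1] -/
theorem missingUpperBoundAt_two_nonsplit_of_towerGapMember_of_katoRatAt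
    (h41ns' : thm41Analogue_charValue_rankZero_numberField_anyPrime_oddLocalDegree)
    (h41sp : thm41Analogue_charValue_rankZero_split_baseChange_anyPrime)
    (hmod : nonempty_modularParametrizationData)
    (hGZK : rank_eq_analyticRank_of_analyticRank_le_one)
    (hCassels : bsdRHS_eq_of_isIsogenous)
    (hC : cesnavicius_not_two_dvd_maninConstant_of_two_dvd_level)
    (W : WeierstrassCurve ℚ) [W.IsElliptic] [W.IsGloballyMinimal]
    (hr : W.analyticRank = 0) (hmult : Mult W 2)
    (W₁ : WeierstrassCurve ℚ) [W₁.IsElliptic] [W₁.IsGloballyMinimal] (hiso : IsIsogenous W W₁)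
    (hKato₁ : O1.KatoMultiplicativeDivisibilityRat W₁ 2)
    (hns₁ : ¬ W₁.HasSplitMultiplicativeReductionAtPrime 2)
    (hgap : O1.TowerGapAtTwo W₁)
    (hB : Irr W₁ 2 ∨
      (∀ [NeZero (W₁.conductorNorm ℤ)],
        ∃ D : ModularParametrizationData W₁ (W₁.conductorNorm ℤ), Zhai2021.IsOptimalDatum W₁ D) ∨
      (∀ [NeZero (W₁.conductorNorm ℤ)] (f : CuspForm (Gamma0 (W₁.conductorNorm ℤ)) 2),
        IsNewformOf W₁ f → ∀ ϖ : ℚ, (ϖ : ℝ) * W₁.realPeriodRat = plusPeriod f →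
          0 ≤ padicValRat 2 ϖ)) :
    MissingUpperBoundAt W 2 := by
  have hmult₁ : Mult W₁ 2 :=
    Summit.BirchSwinnertonDyer.Rank1Residual.X2.IsogenyQuotientLine.hasMultiplicativeReductionAtPrime_of_isIsogenous
      hiso hmult
  have hr₁ : W₁.analyticRank = 0 := (analyticRank_eq_of_isIsogenous' hiso).symm.trans hr
  have hper₁ : ∀ [NeZero (W₁.conductorNorm ℤ)] (f : CuspForm (Gamma0 (W₁.conductorNorm ℤ)) 2),
      IsNewformOf W₁ f → ∀ ϖ : ℚ, (ϖ : ℝ) * W₁.realPeriodRat = plusPeriod f →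
        0 ≤ padicValRat 2 ϖ := by
    rcases hB with hirr | hopt | hper
    · intro _ f hf ϖ hϖ
      exact (padicValRat_periodRatio_eq_zero_of_irr_two hC W₁ hmult₁ hirr f hf ϖ hϖ).ge
    · intro _ f hf ϖ hϖ
      obtain ⟨D, hD⟩ := hopt
      exact (padicValRat_periodRatio_eq_zero_of_isOptimalDatum hC W₁ hmult₁ D hD f hf ϖ hϖ).ge
    · exact hper
  have hU₁ : MissingUpperBoundAt W₁ 2 :=
    missingUpperBoundAt_two_nonsplit_of_towerGap_of_eulerChar W₁ hKato₁
      (O1.twoAdicEulerCharRankZeroNonsplitMult_zero_of_greenberg' W₁ h41ns') h41sp hmod hGZK hper₁ hgap hr₁ hmult₁ hns₁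
  exact missingUpperBoundAt_two_of_isogenous_member hmod hGZK hCassels W hr W₁ hiso hU₁

end Summit.BirchSwinnertonDyer.BirchSwinnertonDyer.Theorems

end
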